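import Mathlib.NumberTheory.Padics.Complex
import Mathlib.RingTheory.RootsOfUnity.Lemmas
import Mathlib.RingTheory.RootsOfUnity.AlgebraicallyClosed
import Mathlib.RingTheory.Polynomial.Cyclotomic.Basic
import Mathlib.Algebra.CharP.Lemmas
import Mathlib.Topology.Algebra.OpenSubgroup
import Mathlib.Topology.Algebra.ContinuousMonoidHom
import HarnessLib

/-!
# The Teichmüller lift of a unit-valued `p`-adic character

Topic `Literature/NumberTheory/GaloisRepresentations`; namespace
`Literature.NumberTheory.GaloisRepresentations`.  THEOREMS ONLY (no definition, no named fact).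

Let `ℚ̄_p = PadicAlgCl p` with its spectral norm `‖·‖` (Mathlib), `𝒪 = {‖x‖ ≤ 1}`,
`𝔪 = {‖x‖ < 1}`.  Elementary facts on roots of unity of order `n` prime to `p`
(Serre, *Local Fields*, II §4, Prop. 8; Washington, *Cyclotomic Fields*, §5.1 (the Teichmüller
character `ω(a) ≡ a mod p`, `ω(a)^{p-1} = 1`); Neukirch, *Algebraic Number Theory*, II (5.3)
and proof of (7.13)):

* `norm_one_sub_pow_eq_one` — for a primitive `n`-th root of unity `ζ`, `p ∤ n`, `0 < k < n`:
  `‖1 - ζ^k‖ = 1` (from `∏_{0<k<n} (1 - ζ^k) = n`, Mathlib `IsPrimitiveRoot.prod_one_sub_pow_eq_order`,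
  and `‖n‖ = 1`); hence **distinct `n`-th roots of unity are incongruent modulo `𝔪`**
  (`eq_of_pow_eq_one_of_norm_sub_lt_one`).
* `exists_pow_eq_one_norm_sub_lt_one` — **every `w ∈ 𝒪` with `w^n ≡ 1 (mod 𝔪)` is congruent
  to an `n`-th root of unity** (`w^n - 1 = ∏_{μ^n = 1} (w - μ)`, Mathlib
  `Polynomial.X_pow_sub_one_eq_prod`; a product of elements of `𝒪` lies in `𝔪` only if a factor
  does) — the Teichmüller representative, unique by the previous item.
* `norm_sub_one_lt_one_of_norm_pow_prime_pow_sub_one_lt_one` — `u^{p^e} ≡ 1 ⇒ u ≡ 1 (mod 𝔪)`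
  for `u ∈ 𝒪` (`(u-1)^{p^e} ≡ u^{p^e} - 1 (mod p𝒪)`, Mathlib `exists_add_pow_prime_pow_eq` in
  the ring `𝒪`).
* `exists_forall_norm_pow_sub_one_lt_one` — for a compact group `G` and a continuous character
  `θ : G → ℚ̄_pˣ` with `‖θ‖ = 1`, there is `n ≥ 1` PRIME TO `p` with `θ(g)^n ≡ 1 (mod 𝔪)` for
  all `g`: the subgroup `H = {‖θ - 1‖ < 1}` is open and normal, of finite index `n₀ = p^e n`,
  `θ(g)^{n₀} ≡ 1`, and the `p`-part is removed by the previous item (a finite subgroup of `k̄_pˣ`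
  has order prime to `p`).
* `exists_teichmullerCharacter` — **the Teichmüller lift**: there are `n ≥ 1` prime to `p` and a
  homomorphism `θ' : G → ℚ̄_pˣ` with `θ'(g)^n = 1`, `θ'(g) ≡ θ(g) (mod 𝔪)`,
  `θ'(g) = 1 ↔ θ(g) ≡ 1 (mod 𝔪)`, and open kernel; and its transport
  `exists_complexCharacter_of_teichmuller` along a ring isomorphism `ι : ℚ̄_p ≃ ℂ`: a character
  `ψ : G → ℂˣ` of finite order prime to `p` with open kernel and `ι⁻¹(ψ(g)) ≡ θ(g) (mod 𝔪)`.
  This is how the characters `ε₁, ε₂ : Γ_ℚ → 𝔽̄_lˣ` of Billerey–Menares are read as complex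
  (Dirichlet) characters: "`χ₁, χ₂` the multiplicative (Teichmüller) lifts of `ε₁, ε₂`" (B–M
  §3.2, proof of Thm. 2).

Valuation form: `Valued.v x ≤ 1 ↔ ‖x‖ ≤ 1`, `Valued.v x = 1 ↔ ‖x‖ = 1`
(`PadicAlgCl.valuation_le_one_iff`, `PadicAlgCl.valuation_eq_one_iff`; Mathlib
`PadicAlgCl.valuation_def : Valued.v x = ‖x‖₊`).

## References

* J.-P. Serre, *Local Fields*, GTM 67 (1979), Ch. II §4, Prop. 8 (Teichmüller representatives).
  [SerreLocalFields1979]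
* L. C. Washington, *Introduction to Cyclotomic Fields*, 2nd ed., GTM 83 (1997), §5.1 (the
  Teichmüller character). [Washington1997]
* N. Billerey, R. Menares, *Strong modularity of reducible Galois representations*, Trans. AMS
  370 (2018), §3.2. [BillereyMenares2018]
-/

noncomputable section

open Polynomial

namespace Literature.NumberTheory.GaloisRepresentations

variable {p : ℕ} [Fact p.Prime]

/-! ### Norm bookkeeping in `ℚ̄_p` -/

section Norm

/-- `Valued.v x < 1 ↔ ‖x‖ < 1` in `ℚ̄_p` (private copy of a one-liner available elsewhere in
the tree). [folklore] -/
private theorem PadicAlgCl.valuation_lt_one_iff (x : PadicAlgCl p) : Valued.v x < 1 ↔ ‖x‖ < 1 := by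
  rw [PadicAlgCl.valuation_def, ← NNReal.coe_lt_coe, coe_nnnorm, NNReal.coe_one]

/-- `Valued.v x ≤ 1 ↔ ‖x‖ ≤ 1` in `ℚ̄_p`. [folklore] -/
theorem PadicAlgCl.valuation_le_one_iff (x : PadicAlgCl p) : Valued.v x ≤ 1 ↔ ‖x‖ ≤ 1 := by
  rw [PadicAlgCl.valuation_def, ← NNReal.coe_le_coe, coe_nnnorm, NNReal.coe_one]

/-- `Valued.v x = 1 ↔ ‖x‖ = 1` in `ℚ̄_p`. [folklore] -/
theorem PadicAlgCl.valuation_eq_one_iff (x : PadicAlgCl p) : Valued.v x = 1 ↔ ‖x‖ = 1 := by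
  rw [PadicAlgCl.valuation_def, ← NNReal.coe_inj, coe_nnnorm, NNReal.coe_one]

/-- `‖n‖ = 1` in `ℚ̄_p` for `p ∤ n`. [folklore] -/
theorem PadicAlgCl.norm_natCast_of_not_dvd {n : ℕ} (hn : ¬ p ∣ n) :
    ‖(n : PadicAlgCl p)‖ = 1 := by
  rw [← map_natCast (algebraMap ℚ_[p] (PadicAlgCl p)) n]
  change ‖((n : ℚ_[p]) : PadicAlgCl p)‖ = 1
  rw [PadicAlgCl.norm_extends, Padic.norm_natCast_eq_one_iff]
  exact (Nat.Prime.coprime_iff_not_dvd Fact.out).2 hn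

/-- `‖p‖ < 1` in `ℚ̄_p` (private copy of `PadicAlgCl.norm_natCast_p_lt_one` of
`HilbertPartialHasseWeightShiftingProofs`, not imported here). [folklore] -/
private theorem PadicAlgCl.norm_natCast_prime_lt_one : ‖(p : PadicAlgCl p)‖ < 1 := by
  rw [← map_natCast (algebraMap ℚ_[p] (PadicAlgCl p)) p]
  change ‖((p : ℚ_[p]) : PadicAlgCl p)‖ < 1
  rw [PadicAlgCl.norm_extends]
  exact Padic.norm_p_lt_one

/-- The ultrametric inequality for differences in `ℚ̄_p` (private helper). [folklore] -/
private theorem PadicAlgCl.norm_sub_le_max (x y : PadicAlgCl p) : ‖x - y‖ ≤ max ‖x‖ ‖y‖ := by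
  have h := PadicAlgCl.isNonarchimedean p x (-y)
  rwa [norm_neg, ← sub_eq_add_neg] at h

/-- Roots of unity have norm `1`. [folklore] -/
theorem PadicAlgCl.norm_eq_one_of_pow_eq_one {x : PadicAlgCl p} {n : ℕ} (hn : n ≠ 0)
    (hx : x ^ n = 1) : ‖x‖ = 1 := by
  have h := congrArg norm hx
  rw [norm_pow, norm_one] at h
  exact (pow_eq_one_iff_of_nonneg (norm_nonneg _) hn).1 h

/-- In a product of reals in `[0, 1]` equal to `1`, every factor is `1`. [folklore] -/
theorem eq_one_of_prod_eq_one {ι : Type*} {s : Finset ι} {f : ι → ℝ} (h0 : ∀ i ∈ s, 0 ≤ f i)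
    (h1 : ∀ i ∈ s, f i ≤ 1) (hprod : ∏ i ∈ s, f i = 1) (i : ι) (hi : i ∈ s) : f i = 1 := by
  classical
  by_contra hne
  have hlt : f i < 1 := lt_of_le_of_ne (h1 i hi) hne
  have hrest : ∏ j ∈ s.erase i, f j ≤ 1 :=
    Finset.prod_le_one (fun j hj ↦ h0 j (Finset.mem_of_mem_erase hj))
      fun j hj ↦ h1 j (Finset.mem_of_mem_erase hj)
  have hrest0 : 0 ≤ ∏ j ∈ s.erase i, f j :=
    Finset.prod_nonneg fun j hj ↦ h0 j (Finset.mem_of_mem_erase hj)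
  have h3 := Finset.mul_prod_erase s f hi
  rw [hprod] at h3
  have h4 : f i * ∏ j ∈ s.erase i, f j ≤ f i := by
    calc f i * ∏ j ∈ s.erase i, f j ≤ f i * 1 := mul_le_mul_of_nonneg_left hrest (h0 i hi)
      _ = f i := mul_one _
  linarith

/-- A product of reals in `[0, 1]` which is `< 1` has a factor `< 1`. [folklore] -/
theorem exists_lt_one_of_prod_lt_one {ι : Type*} {s : Finset ι} {f : ι → ℝ}
    (hprod : ∏ i ∈ s, f i < 1) : ∃ i ∈ s, f i < 1 := by
  by_contra h
  simp only [not_exists, not_and, not_lt] at h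
  have h1 : (1 : ℝ) ≤ ∏ i ∈ s, f i := by
    calc (1 : ℝ) = ∏ _i ∈ s, (1 : ℝ) := Finset.prod_const_one.symm
      _ ≤ ∏ i ∈ s, f i := Finset.prod_le_prod (fun _ _ ↦ zero_le_one) h
  exact absurd hprod (not_lt.2 h1)

end Norm

/-! ### Roots of unity of order prime to `p` are incongruent modulo `𝔪` -/

section RootsOfUnity

/-- **`‖1 - ζ^k‖ = 1` for a primitive `n`-th root of unity `ζ ∈ ℚ̄_p`, `p ∤ n`, `0 < k < n`**:
`∏_{0 < k < n} (1 - ζ^k) = n` has norm `1` and every factor has norm `≤ 1`.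
[cite: SerreLocalFields1979, Ch. II §4, Prop. 8; Washington1997, §5.1] -/
theorem norm_one_sub_pow_eq_one {ζ : PadicAlgCl p} {n : ℕ} (hζ : IsPrimitiveRoot ζ n)
    (hn : ¬ p ∣ n) {k : ℕ} (hk0 : 0 < k) (hkn : k < n) : ‖1 - ζ ^ k‖ = 1 := by
  obtain ⟨m, rfl⟩ : ∃ m, n = m + 1 := ⟨n - 1, by omega⟩
  have hζ1 : ‖ζ‖ = 1 := PadicAlgCl.norm_eq_one_of_pow_eq_one (by omega) hζ.pow_eq_one
  have hprod := hζ.prod_one_sub_pow_eq_order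
  have hnorm : ∏ j ∈ Finset.range m, ‖1 - ζ ^ (j + 1)‖ = 1 := by
    rw [← norm_prod, hprod, show ((m : PadicAlgCl p) + 1) = ((m + 1 : ℕ) : PadicAlgCl p) by
      push_cast; ring, PadicAlgCl.norm_natCast_of_not_dvd hn]
  have hle : ∀ j ∈ Finset.range m, ‖1 - ζ ^ (j + 1)‖ ≤ 1 := fun j _ ↦ by
    refine (PadicAlgCl.norm_sub_le_max _ _).trans ?_
    rw [norm_one, norm_pow, hζ1, one_pow, max_self]
  have h := eq_one_of_prod_eq_one (fun j _ ↦ norm_nonneg _) hle hnorm (k - 1)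
    (Finset.mem_range.2 (by omega))
  rwa [Nat.sub_add_cancel hk0] at h

/-- **Distinct `n`-th roots of unity (`p ∤ n`) are incongruent modulo `𝔪`**: if `μ^n = ν^n = 1`
and `‖μ - ν‖ < 1` then `μ = ν`. [cite: SerreLocalFields1979, Ch. II §4, Prop. 8] -/
theorem eq_of_pow_eq_one_of_norm_sub_lt_one {n : ℕ} (hn0 : 0 < n) (hn : ¬ p ∣ n)
    {μ ν : PadicAlgCl p} (hμ : μ ^ n = 1) (hν : ν ^ n = 1) (h : ‖μ - ν‖ < 1) : μ = ν := by
  haveI : NeZero n := ⟨hn0.ne'⟩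
  obtain ⟨ζ, hζ⟩ := HasEnoughRootsOfUnity.exists_primitiveRoot (PadicAlgCl p) n
  obtain ⟨i, hi, rfl⟩ := hζ.eq_pow_of_pow_eq_one hμ
  obtain ⟨j, hj, rfl⟩ := hζ.eq_pow_of_pow_eq_one hν
  have hζ1 : ‖ζ‖ = 1 := PadicAlgCl.norm_eq_one_of_pow_eq_one hn0.ne' hζ.pow_eq_one
  by_contra hne
  rcases Nat.lt_or_gt_of_ne (fun hij : i = j ↦ hne (by rw [hij])) with hij | hij
  · -- `ζ^i - ζ^j = ζ^i (1 - ζ^(j-i))`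
    have heq : ζ ^ i - ζ ^ j = ζ ^ i * (1 - ζ ^ (j - i)) := by
      rw [mul_sub, mul_one, ← pow_add, Nat.add_sub_cancel' hij.le]
    rw [heq, norm_mul, norm_pow, hζ1, one_pow, one_mul,
      norm_one_sub_pow_eq_one hζ hn (Nat.sub_pos_of_lt hij) (by omega)] at h
    exact lt_irrefl _ h
  · have heq : ζ ^ i - ζ ^ j = -(ζ ^ j * (1 - ζ ^ (i - j))) := by
      rw [mul_sub, mul_one, ← pow_add, Nat.add_sub_cancel' hij.le, neg_sub]
    rw [heq, norm_neg, norm_mul, norm_pow, hζ1, one_pow, one_mul,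
      norm_one_sub_pow_eq_one hζ hn (Nat.sub_pos_of_lt hij) (by omega)] at h
    exact lt_irrefl _ h

/-- **Teichmüller representatives**: every `w ∈ 𝒪` with `‖w^n - 1‖ < 1` (`n ≥ 1`) is congruent
modulo `𝔪` to an `n`-th root of unity `μ`: `w^n - 1 = ∏_{μ^n = 1} (w - μ)` and a product of
elements of norm `≤ 1` has norm `< 1` only if some factor does.
[cite: SerreLocalFields1979, Ch. II §4, Prop. 8] -/
theorem exists_pow_eq_one_norm_sub_lt_one {w : PadicAlgCl p} {n : ℕ} (hn0 : 0 < n)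
    (hwn : ‖w ^ n - 1‖ < 1) : ∃ μ : PadicAlgCl p, μ ^ n = 1 ∧ ‖w - μ‖ < 1 := by
  haveI : NeZero n := ⟨hn0.ne'⟩
  obtain ⟨ζ, hζ⟩ := HasEnoughRootsOfUnity.exists_primitiveRoot (PadicAlgCl p) n
  have hfac := X_pow_sub_one_eq_prod hn0 hζ
  have heval : w ^ n - 1 = ∏ μ ∈ nthRootsFinset n (1 : PadicAlgCl p), (w - μ) := by
    have h := congrArg (Polynomial.eval w) hfac
    simpa [eval_prod] using h
  rw [heval, norm_prod] at hwn
  obtain ⟨μ, hμ, hlt⟩ := exists_lt_one_of_prod_lt_one hwn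
  exact ⟨μ, (mem_nthRootsFinset hn0 1).1 hμ, hlt⟩

/-- **Removing the `p`-part**: for `u ∈ 𝒪`, `‖u^{p^e} - 1‖ < 1 ⇒ ‖u - 1‖ < 1`
(`(u-1)^{p^e} = u^{p^e} - 1 - p(u-1)r` with `r ∈ 𝒪`, Mathlib `exists_add_pow_prime_pow_eq`
in the valuation ring; so `‖u-1‖ = 1` would force `1 ≤ max ‖u^{p^e}-1‖ ‖p‖ < 1`).  Equivalently:
the multiplicative group of the residue field `k̄_p` has no `p`-torsion. [folklore] -/
theorem norm_sub_one_lt_one_of_norm_pow_prime_pow_sub_one_lt_one {u : PadicAlgCl p}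
    (hu : ‖u‖ ≤ 1) (e : ℕ) (h : ‖u ^ p ^ e - 1‖ < 1) : ‖u - 1‖ < 1 := by
  set O := (Valued.v (R := PadicAlgCl p)).valuationSubring with hO
  have hmem : ∀ x : PadicAlgCl p, x ∈ O ↔ ‖x‖ ≤ 1 := fun x ↦ by
    rw [Valuation.mem_valuationSubring_iff, PadicAlgCl.valuation_le_one_iff]
  have hu1 : u - 1 ∈ O := by
    rw [hmem]
    refine (PadicAlgCl.norm_sub_le_max _ _).trans ?_
    rw [norm_one]
    exact max_le hu le_rfl
  set x : O := ⟨u - 1, hu1⟩ with hx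
  obtain ⟨r, hr⟩ := exists_add_pow_prime_pow_eq (Fact.out : p.Prime) x 1 e
  have hxval : ((x : O) : PadicAlgCl p) = u - 1 := rfl
  have hr' : u ^ p ^ e = (u - 1) ^ p ^ e + 1 + (p : PadicAlgCl p) * (u - 1) * (r : PadicAlgCl p) := by
    have h := congrArg ((↑) : O → PadicAlgCl p) hr
    push_cast at h
    simp only [hxval, one_pow, mul_one, sub_add_cancel] at h
    exact h
  have hkey : (u - 1) ^ p ^ e = (u ^ p ^ e - 1) - (p : PadicAlgCl p) * (u - 1) * (r : PadicAlgCl p) := by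
    rw [hr']; ring
  by_contra hnot
  have heq : ‖u - 1‖ = 1 := le_antisymm ((hmem _).1 hu1) (not_lt.1 hnot)
  have hr1 : ‖(r : PadicAlgCl p)‖ ≤ 1 := (hmem _).1 r.2
  have h2 : ‖(p : PadicAlgCl p) * (u - 1) * (r : PadicAlgCl p)‖ < 1 := by
    rw [norm_mul, norm_mul, heq, mul_one]
    calc ‖(p : PadicAlgCl p)‖ * ‖(r : PadicAlgCl p)‖ ≤ ‖(p : PadicAlgCl p)‖ * 1 :=
          mul_le_mul_of_nonneg_left hr1 (norm_nonneg _)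
      _ < 1 := by rw [mul_one]; exact PadicAlgCl.norm_natCast_prime_lt_one
  have h3 : ‖(u - 1) ^ p ^ e‖ < 1 := by
    rw [hkey]
    exact (PadicAlgCl.norm_sub_le_max _ _).trans_lt (max_lt h h2)
  rw [norm_pow, heq, one_pow] at h3
  exact lt_irrefl _ h3

end RootsOfUnity

/-! ### Unit-valued characters of a compact group -/

section Character

variable {G : Type*} [Group G] [TopologicalSpace G] [IsTopologicalGroup G] [CompactSpace G]

/-- **A unit-valued continuous character of a compact group is congruent to `1` on an open normal
subgroup of finite index, and `θ^n ≡ 1 (mod 𝔪)` for some `n ≥ 1` prime to `p`**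
(`H = {g : ‖θ(g) - 1‖ < 1}` is an open subgroup; `θ(g)^{[G:H]} ∈ θ(H)`; remove the `p`-part
of `[G : H]` by `norm_sub_one_lt_one_of_norm_pow_prime_pow_sub_one_lt_one`). [folklore] -/
theorem exists_forall_norm_pow_sub_one_lt_one (θ : G →ₜ* (PadicAlgCl p)ˣ)
    (hθ : ∀ g, ‖((θ g : (PadicAlgCl p)ˣ) : PadicAlgCl p)‖ = 1) :
    ∃ n : ℕ, 0 < n ∧ ¬ p ∣ n ∧ ∀ g, ‖((θ g : (PadicAlgCl p)ˣ) : PadicAlgCl p) ^ n - 1‖ < 1 := by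
  -- the subgroup `H = {‖θ - 1‖ < 1}`
  let H : Subgroup G :=
    { carrier := {g | ‖((θ g : (PadicAlgCl p)ˣ) : PadicAlgCl p) - 1‖ < 1}
      mul_mem' := fun {a b} ha hb ↦ by
        simp only [Set.mem_setOf_eq, map_mul, Units.val_mul] at ha hb ⊢
        have heq : ((θ a : (PadicAlgCl p)ˣ) : PadicAlgCl p) * (θ b : (PadicAlgCl p)ˣ) - 1 =
            (θ a : (PadicAlgCl p)ˣ) * (((θ b : (PadicAlgCl p)ˣ) : PadicAlgCl p) - 1) +
              (((θ a : (PadicAlgCl p)ˣ) : PadicAlgCl p) - 1) := by ring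
        rw [heq]
        refine (PadicAlgCl.isNonarchimedean p _ _).trans_lt (max_lt ?_ ha)
        rw [norm_mul, hθ, one_mul]
        exact hb
      one_mem' := by simp
      inv_mem' := fun {a} ha ↦ by
        simp only [Set.mem_setOf_eq, map_inv, Units.val_inv_eq_inv_val] at ha ⊢
        have hne : ((θ a : (PadicAlgCl p)ˣ) : PadicAlgCl p) ≠ 0 := (θ a).ne_zero
        have heq : (((θ a : (PadicAlgCl p)ˣ) : PadicAlgCl p))⁻¹ - 1 =
            (((θ a : (PadicAlgCl p)ˣ) : PadicAlgCl p))⁻¹ *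
              -(((θ a : (PadicAlgCl p)ˣ) : PadicAlgCl p) - 1) := by
          field_simp
          ring
        rw [heq, norm_mul, norm_inv, hθ, inv_one, one_mul, norm_neg]
        exact ha }
  have hHmem : ∀ g, g ∈ H ↔ ‖((θ g : (PadicAlgCl p)ˣ) : PadicAlgCl p) - 1‖ < 1 := fun g ↦ Iff.rfl
  -- open (preimage of an open ball), normal (abelian target), hence of finite index `n₀ ≥ 1`
  have hopen : IsOpen (H : Set G) := by
    have hc : Continuous fun g ↦ ‖((θ g : (PadicAlgCl p)ˣ) : PadicAlgCl p) - 1‖ :=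
      ((Units.continuous_val.comp θ.continuous_toFun).sub continuous_const).norm
    exact isOpen_lt hc continuous_const
  haveI hnormal : H.Normal := ⟨fun g hg x ↦ by
    rw [hHmem] at hg ⊢
    rwa [map_mul, map_mul, map_inv, mul_inv_cancel_comm]⟩
  haveI : Finite (G ⧸ H) := H.quotient_finite_of_isOpen hopen
  have hidx : H.index ≠ 0 := Subgroup.index_ne_zero_of_finite
  -- remove the `p`-part of the index
  obtain ⟨e, n, hn, hidxeq⟩ := Nat.exists_eq_pow_mul_and_not_dvd hidx p
    (Nat.Prime.ne_one Fact.out)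
  have hn0 : 0 < n := Nat.pos_of_ne_zero fun h ↦ hidx (by rw [hidxeq, h, mul_zero])
  refine ⟨n, hn0, hn, fun g ↦ ?_⟩
  have hmemidx : g ^ H.index ∈ H := H.pow_index_mem g
  rw [hHmem, map_pow, Units.val_pow_eq_pow_val, hidxeq, mul_comm, pow_mul] at hmemidx
  refine norm_sub_one_lt_one_of_norm_pow_prime_pow_sub_one_lt_one ?_ e hmemidx
  rw [norm_pow, hθ, one_pow]

/-- **The Teichmüller lift of a unit-valued continuous character of a compact group.**  For
`θ : G → ℚ̄_pˣ` continuous with `‖θ‖ = 1` there are `n ≥ 1` prime to `p` and a homomorphism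
`θ' : G → ℚ̄_pˣ` with values `n`-th roots of unity such that `θ'(g) ≡ θ(g) (mod 𝔪)` for all `g`;
moreover `θ'(g) = 1 ↔ θ(g) ≡ 1 (mod 𝔪)`, and `ker θ'` is open.  (`θ'(g)` is the unique `n`-th
root of unity congruent to `θ(g)`; multiplicativity by uniqueness.)
[cite: SerreLocalFields1979, Ch. II §4, Prop. 8; Washington1997, §5.1] -/
theorem exists_teichmullerCharacter (θ : G →ₜ* (PadicAlgCl p)ˣ)
    (hθ : ∀ g, ‖((θ g : (PadicAlgCl p)ˣ) : PadicAlgCl p)‖ = 1) :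
    ∃ (n : ℕ) (θ' : G →* (PadicAlgCl p)ˣ), 0 < n ∧ ¬ p ∣ n ∧
      (∀ g, θ' g ^ n = 1) ∧
      (∀ g, ‖((θ' g : (PadicAlgCl p)ˣ) : PadicAlgCl p) - (θ g : (PadicAlgCl p)ˣ)‖ < 1) ∧
      (∀ g, θ' g = 1 ↔ ‖((θ g : (PadicAlgCl p)ˣ) : PadicAlgCl p) - 1‖ < 1) ∧
      IsOpen ((θ'.ker : Subgroup G) : Set G) := by
  obtain ⟨n, hn0, hn, hpow⟩ := exists_forall_norm_pow_sub_one_lt_one θ hθ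
  -- the Teichmüller representative of `θ g`
  have hex : ∀ g, ∃ μ : PadicAlgCl p, μ ^ n = 1 ∧
      ‖((θ g : (PadicAlgCl p)ˣ) : PadicAlgCl p) - μ‖ < 1 := fun g ↦
    exists_pow_eq_one_norm_sub_lt_one hn0 (hpow g)
  choose μ hμn hμθ using hex
  have hμ0 : ∀ g, μ g ≠ 0 := fun g h0 ↦ by
    have := hμn g
    rw [h0, zero_pow hn0.ne'] at this
    exact zero_ne_one this
  -- uniqueness of the representative
  have huniq : ∀ g (ν : PadicAlgCl p), ν ^ n = 1 →
      ‖((θ g : (PadicAlgCl p)ˣ) : PadicAlgCl p) - ν‖ < 1 → ν = μ g := fun g ν hν hνθ ↦ by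
    refine eq_of_pow_eq_one_of_norm_sub_lt_one hn0 hn hν (hμn g) ?_
    have heq : ν - μ g = (((θ g : (PadicAlgCl p)ˣ) : PadicAlgCl p) - μ g) -
        (((θ g : (PadicAlgCl p)ˣ) : PadicAlgCl p) - ν) := by ring
    rw [heq]
    exact (PadicAlgCl.norm_sub_le_max _ _).trans_lt (max_lt (hμθ g) hνθ)
  -- multiplicativity
  have hmul : ∀ a b, μ (a * b) = μ a * μ b := fun a b ↦ by
    symm
    refine huniq (a * b) _ (by rw [mul_pow, hμn, hμn, one_mul]) ?_
    rw [map_mul, Units.val_mul]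
    have heq : ((θ a : (PadicAlgCl p)ˣ) : PadicAlgCl p) * (θ b : (PadicAlgCl p)ˣ) - μ a * μ b =
        (θ a : (PadicAlgCl p)ˣ) * (((θ b : (PadicAlgCl p)ˣ) : PadicAlgCl p) - μ b) +
          (((θ a : (PadicAlgCl p)ˣ) : PadicAlgCl p) - μ a) * μ b := by ring
    rw [heq]
    refine (PadicAlgCl.isNonarchimedean p _ _).trans_lt (max_lt ?_ ?_)
    · rw [norm_mul, hθ, one_mul]; exact hμθ b
    · rw [norm_mul, PadicAlgCl.norm_eq_one_of_pow_eq_one hn0.ne' (hμn b), mul_one]; exact hμθ a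
  let θ' : G →* (PadicAlgCl p)ˣ := MonoidHom.mk' (fun g ↦ Units.mk0 (μ g) (hμ0 g)) fun a b ↦ by
    ext; simp [hmul]
  have hθ'val : ∀ g, ((θ' g : (PadicAlgCl p)ˣ) : PadicAlgCl p) = μ g := fun g ↦ rfl
  have hker : ∀ g, θ' g = 1 ↔ ‖((θ g : (PadicAlgCl p)ˣ) : PadicAlgCl p) - 1‖ < 1 := fun g ↦ by
    constructor
    · intro h
      have h1 : μ g = 1 := by rw [← hθ'val, h, Units.val_one]
      simpa [h1] using hμθ g
    · intro h
      ext
      rw [hθ'val, Units.val_one]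
      exact (huniq g 1 (one_pow n) h).symm
  refine ⟨n, θ', hn0, hn, fun g ↦ ?_, fun g ↦ ?_, hker, ?_⟩
  · ext
    rw [Units.val_pow_eq_pow_val, hθ'val, hμn, Units.val_one]
  · rw [hθ'val, ← norm_neg, neg_sub]
    exact hμθ g
  · have hset : ((θ'.ker : Subgroup G) : Set G) =
        {g | ‖((θ g : (PadicAlgCl p)ˣ) : PadicAlgCl p) - 1‖ < 1} := by
      ext g
      rw [SetLike.mem_coe, MonoidHom.mem_ker, hker, Set.mem_setOf_eq]
    rw [hset]
    have hc : Continuous fun g ↦ ‖((θ g : (PadicAlgCl p)ˣ) : PadicAlgCl p) - 1‖ :=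
      ((Units.continuous_val.comp θ.continuous_toFun).sub continuous_const).norm
    exact isOpen_lt hc continuous_const

/-- **Complex form of the Teichmüller lift.**  For `θ : G → ℚ̄_pˣ` continuous unit-valued and a
ring isomorphism `ι : ℚ̄_p ≃ ℂ` there are `n ≥ 1` prime to `p` and a character `ψ : G → ℂˣ`
with `ψ^n = 1`, open kernel, `ι⁻¹(ψ(g)) ≡ θ(g) (mod 𝔪)`, and `ψ(g) = 1 ↔ θ(g) ≡ 1 (mod 𝔪)` —
the way `\bar 𝔽_l`-valued characters are read in `ℂ` in Billerey–Menares §3.2.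
[cite: BillereyMenares2018, §3.2; Washington1997, §5.1] -/
theorem exists_complexCharacter_of_teichmuller (ι : PadicAlgCl p ≃+* ℂ)
    (θ : G →ₜ* (PadicAlgCl p)ˣ) (hθ : ∀ g, ‖((θ g : (PadicAlgCl p)ˣ) : PadicAlgCl p)‖ = 1) :
    ∃ (n : ℕ) (ψ : G →* ℂˣ), 0 < n ∧ ¬ p ∣ n ∧
      (∀ g, ψ g ^ n = 1) ∧
      (∀ g, ‖ι.symm ((ψ g : ℂˣ) : ℂ) - (θ g : (PadicAlgCl p)ˣ)‖ < 1) ∧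
      (∀ g, ψ g = 1 ↔ ‖((θ g : (PadicAlgCl p)ˣ) : PadicAlgCl p) - 1‖ < 1) ∧
      IsOpen ((ψ.ker : Subgroup G) : Set G) := by
  obtain ⟨n, θ', hn0, hn, hpow, hcong, hker, hopen⟩ := exists_teichmullerCharacter θ hθ
  let ψ : G →* ℂˣ := (Units.map (ι : PadicAlgCl p →* ℂ)).comp θ'
  have hψval : ∀ g, ((ψ g : ℂˣ) : ℂ) = ι ((θ' g : (PadicAlgCl p)ˣ) : PadicAlgCl p) := fun g ↦ rfl
  have hψone : ∀ g, ψ g = 1 ↔ θ' g = 1 := fun g ↦ by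
    rw [Units.ext_iff, Units.ext_iff, hψval, Units.val_one, Units.val_one]
    exact ι.map_eq_one_iff
  refine ⟨n, ψ, hn0, hn, fun g ↦ ?_, fun g ↦ ?_, fun g ↦ (hψone g).trans (hker g), ?_⟩
  · ext
    rw [Units.val_pow_eq_pow_val, hψval, ← map_pow, ← Units.val_pow_eq_pow_val, hpow,
      Units.val_one, map_one, Units.val_one]
  · rw [hψval, RingEquiv.symm_apply_apply]
    exact hcong g
  · have hset : ((ψ.ker : Subgroup G) : Set G) = ((θ'.ker : Subgroup G) : Set G) := by
      ext g
      rw [SetLike.mem_coe, SetLike.mem_coe, MonoidHom.mem_ker, MonoidHom.mem_ker, hψone]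
    rw [hset]
    exact hopen

end Character

end Literature.NumberTheory.GaloisRepresentations
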